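/-
Copyright (c) 2026 the pub-hodgecm-mathlib formalisation cell (harness21).  Prover seat hodgecm-mathlib-LH5-p04 (g7): sub-road «LH5c-SIM» (LEAD F0P3a-plan (g15) T14-38,
desk F0P3-plan (g18) 19:49Z ∕ 19:53Z), §K «ADELIC SIMILITUDE ISO KIT» of SIGSHEET v3 8caf17033962af60 (2026-09-02).
-/
import Literature.NumberTheory.Automorphic.AdelicCongruenceArchFinCompat     -- ★ `archPart_∕finPart_adelicUnitaryGroupCongr` proofs' currency: `toMixed_toAdeleGL`, `sndHom_toAdeleGL`
import Literature.NumberTheory.Automorphic.AdelicUnitaryCentralizerCovolCongr -- ★ `adelicUnitaryGroupCongr_mem_quotientSubgroup_iff`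
import Literature.NumberTheory.Automorphic.UnitaryGroupLevelTransport         -- ★ `finAdelicCongr`, `finAdelic_smul`, `toFinAdeleGL`
import Literature.NumberTheory.Automorphic.UnitaryGroupArchProjection         -- ★ `subgroupCongrTop`, `coe_subgroupCongrTop_apply`
import Literature.NumberTheory.Weil1964.UnitaryArchTopFormHaarFormScaling    -- ★ `arch_smul`, `archFormOf_smul`
import Literature.NumberTheory.Rogawski1990.KottwitzSteinbergUnitaryCM        -- ★ `unitaryGroup_smul_eq`
import HarnessLib

/-!
# The adelic ∕ archimedean ∕ finite-adelic isomorphisms `x ↦ Q x Q⁻¹` along a rational SIMILITUDE `ᵗ(σQ)·H·Q = c • H′`, characterised by their values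
# (Platonov–Rapinchuk 1994 §2.3, §5.1; Borel–Jacquet 1979 §4.1; Rogawski 1990 §1.7, §14.5)

Topic `NumberTheory/Automorphic`; namespace `Literature.NumberTheory.Automorphic.UnitaryGroup`.  THEOREMS ONLY (no definition, no instance, no notation, no named fact,
no `sorry`).  Cell `pub/hodgecm-mathlib`, crux H413 = `stmt-HodgeConjecture-24833` (supports-only, count-neutral), half A line LH5, sub-road «LH5c-SIM» (LEAD T14-38):
§K of SIGSHEET v3 `SIG-LH5cSIM.v3` (LH5-p04 (g7); LHref-S BOX #17 «=»), consumed BY NAME by the similitude transport `TamagawaBlockModel.recipeCovol_eq_of_similar`.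

THE MATHEMATICS.  For hermitian `H, H′ ∈ M_N(L)` over the CM field `L` with `ᵗ(σQ)·H·Q = c • H′`, `Q ∈ GL_N(L)`, `c ∈ L×`, conjugation `x ↦ Q x Q⁻¹` is an isomorphism
of topological groups `U(H′)(𝔸_{L⁺}) ≃ U(H)(𝔸_{L⁺})` (the unitary group ignores the scalar: `U(c • H′) = U(H′)` at every level, ★ `unitaryGroup_smul_eq`), and likewise at the
archimedean and finite-adelic factors.  Every consumer only needs the VALUE LAW `(Φ x) = Q·x·Q⁻¹` (the interface of ★ `map_archTopFormHaar_of_simil`), so this file proves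
(K0) existence of the adelic iso with its value law (★ `adelicUnitaryGroupCongr` at `H′ ↦ c • H′` composed with the identity hop ★ `subgroupCongrTop`), (K0∞) the same at the
archimedean factor (★ `unitaryGroupOfFormCongrOfEq` at `archFormOf (c • H′)` ∘ ★ `arch_smul`), (Kf) the similitude hypothesis in the shape ★ `finAdelicCongr` consumes, and, for ANY
isos satisfying the value laws, (K3) lattice ↔ lattice, (K4) `archPart ∘ Φ = Φ∞ ∘ archPart`, (K5) `finPart ∘ Φ = Φf ∘ finPart`, (K6) `Φ ∘ e′⁻¹ = e⁻¹ ∘ (Φ∞ × Φf)`.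
HONEST LABEL: bookkeeping; proves no printed statement; HC_CM is proved only modulo the 7 printed citations (2 remaining: hLiu418 = stmt-HodgeConjecture-24832, h413 =
stmt-HodgeConjecture-24833) until rung 0 closes.

## References
* [PlatonovRapinchuk1994] V. Platonov, A. Rapinchuk, *Algebraic Groups and Number Theory* (1994), §2.3 (equivalent forms have conjugate unitary groups), §5.1 (`G(𝔸) = G_∞ × G(𝔸_f)`).
* [BorelJacquet1979] A. Borel, H. Jacquet, *Automorphic forms and automorphic representations*, PSPM 33.1 (1979), §4.1.
* [Rogawski1990] J. D. Rogawski, *Automorphic Representations of Unitary Groups in Three Variables*, Ann. of Math. Stud. 123 (1990), §1.7 p. 6; §14.5 pp. 238–239.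
-/

set_option autoImplicit false

noncomputable section

open NumberField NumberField.InfinitePlace NumberField.mixedEmbedding IsDedekindDomain
open Literature.AlgebraicGeometry.ShimuraVarieties (unitaryGroup hermForm)
open scoped Matrix MatrixGroups

namespace Literature.NumberTheory.Automorphic

namespace UnitaryGroup

section Simil

variable (L : Type) [Field L] [NumberField L] [IsCMField L] (N : ℕ) (Ha Ha' : Matrix (Fin N) (Fin N) L)

/-! ## §0 the identity hop `U(c • H)(𝔸) = U(H)(𝔸)` (private plumbing) -/

/-- `U(c • H)(𝔸) = U(H)(𝔸)` as subgroups of `GL_N(𝔸_L)` for `c ≠ 0`. [folklore] -/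
private theorem simil_adelicUnitaryGroup_smul_eq {c : L} (hc : c ≠ 0) (H : Matrix (Fin N) (Fin N) L) :
    adelicUnitaryGroup L (c • H) = adelicUnitaryGroup L H := by
  have hmap : (c • H).map (algebraMap L (AdeleRing (𝓞 L) L)) = algebraMap L (AdeleRing (𝓞 L) L) c • H.map (algebraMap L (AdeleRing (𝓞 L) L)) := by
    funext i j
    simp only [Matrix.map_apply, Matrix.smul_apply, smul_eq_mul, map_mul]
  unfold adelicUnitaryGroup
  rw [hmap, Literature.NumberTheory.Rogawski1990.unitaryGroup_smul_eq _ ((IsUnit.mk0 _ hc).map _)]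

/-! ## §K0 existence of the adelic similitude iso, with its value law -/

/-- **(K0)** along `ᵗ(σQ)·Ha·Q = c • Ha′` there is an isomorphism of topological groups `Φ : U(Ha′)(𝔸_{L⁺}) ≃ₜ* U(Ha)(𝔸_{L⁺})` with `Φ x = Q_𝔸 · x · Q_𝔸⁻¹`
(★ `adelicUnitaryGroupCongr` at `H′ ↦ c • Ha′`, preceded by the identity `U(Ha′)(𝔸) = U(c • Ha′)(𝔸)`). [cite: PlatonovRapinchuk1994, §2.3, §5.1] -/
theorem exists_adelicSimilCongr (c : L) (hc : c ≠ 0) (Q : GL (Fin N) L)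
    (hQ : (((Q : GL (Fin N) L) : Matrix (Fin N) (Fin N) L).map (cmConjRingHom L))ᵀ * Ha * ((Q : GL (Fin N) L) : Matrix (Fin N) (Fin N) L) = c • Ha') :
    ∃ Φ : (cmDatum L N Ha').Adelic ≃ₜ* (cmDatum L N Ha).Adelic,
      ∀ x : (cmDatum L N Ha').Adelic, (Subtype.val (Φ x) : GL (Fin N) (AdeleRing (𝓞 L) L)) = toAdeleGL L Q * (Subtype.val x : GL (Fin N) (AdeleRing (𝓞 L) L)) * (toAdeleGL L Q)⁻¹ := by
  have hA : adelicUnitaryGroup L Ha' = adelicUnitaryGroup L (c • Ha') := (simil_adelicUnitaryGroup_smul_eq L N hc Ha').symm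
  refine ⟨(subgroupCongrTop hA).trans (adelicUnitaryGroupCongr L Q Ha (c • Ha') hQ), fun x => ?_⟩
  show (Subtype.val (adelicUnitaryGroupCongr L Q Ha (c • Ha') hQ (subgroupCongrTop hA x)) : GL (Fin N) (AdeleRing (𝓞 L) L)) = _
  rw [coe_adelicUnitaryGroupCongr, coe_subgroupCongrTop_apply]

/-! ## §K0∞ existence of the archimedean similitude iso, with its value law -/

/-- **(K0∞)** along `ᵗ(σQ)·Ha·Q = c • Ha′` there is `Φ∞ : U(Ha′)(L⁺ ⊗ ℝ) ≃ₜ* U(Ha)(L⁺ ⊗ ℝ)` with `Φ∞ g = (Q ⊗ 1) · g · (Q ⊗ 1)⁻¹` (★ `unitaryGroupOfFormCongrOfEq` at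
`archFormOf (c • Ha′)` — ★ `archFormOf_formCongr` — preceded by the identity `U(Ha′)_∞ = U(c • Ha′)_∞`, ★ `arch_smul`). [cite: PlatonovRapinchuk1994, §2.3] [cite: BorelJacquet1979, §4.1] -/
theorem exists_archSimilCongr (c : L) (hc : c ≠ 0) (Q : GL (Fin N) L)
    (hQ : (((Q : GL (Fin N) L) : Matrix (Fin N) (Fin N) L).map (cmConjRingHom L))ᵀ * Ha * ((Q : GL (Fin N) L) : Matrix (Fin N) (Fin N) L) = c • Ha') :
    ∃ Φi : ↥(arch (↥(maximalRealSubfield L)) L (IsCMField.complexConj L) N Ha') ≃ₜ* ↥(arch (↥(maximalRealSubfield L)) L (IsCMField.complexConj L) N Ha),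
      ∀ g : ↥(arch (↥(maximalRealSubfield L)) L (IsCMField.complexConj L) N Ha'),
        ((Φi g : ↥(arch (↥(maximalRealSubfield L)) L (IsCMField.complexConj L) N Ha)) : GL (Fin N) (mixedSpace L)) =
          Matrix.GeneralLinearGroup.map (mixedEmbedding L) Q * (g : GL (Fin N) (mixedSpace L)) * (Matrix.GeneralLinearGroup.map (mixedEmbedding L) Q)⁻¹ := by
  have hR : arch (↥(maximalRealSubfield L)) L (IsCMField.complexConj L) N Ha' = arch (↥(maximalRealSubfield L)) L (IsCMField.complexConj L) N (c • Ha') :=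
    (Literature.NumberTheory.Weil1964.UnitaryArchTopForm.arch_smul (F := ↥(maximalRealSubfield L)) (c := IsCMField.complexConj L) hc Ha').symm
  have hS : formCongr (conjMixed (↥(maximalRealSubfield L)) L (IsCMField.complexConj L)) (Matrix.GeneralLinearGroup.map (mixedEmbedding L) Q)
      (archFormOf L N Ha) = archFormOf L N (c • Ha') := by
    rw [← archFormOf_formCongr]
    exact congrArg (archFormOf L N) hQ
  refine ⟨(subgroupCongrTop hR).trans
      (unitaryGroupOfFormCongrOfEq (conjMixed (↥(maximalRealSubfield L)) L (IsCMField.complexConj L)) (Matrix.GeneralLinearGroup.map (mixedEmbedding L) Q)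
        (archFormOf L N Ha) (archFormOf L N (c • Ha')) hS), fun g => ?_⟩
  show ((unitaryGroupOfFormCongrOfEq (conjMixed (↥(maximalRealSubfield L)) L (IsCMField.complexConj L)) (Matrix.GeneralLinearGroup.map (mixedEmbedding L) Q)
      (archFormOf L N Ha) (archFormOf L N (c • Ha')) hS (subgroupCongrTop hR g) : ↥(arch (↥(maximalRealSubfield L)) L (IsCMField.complexConj L) N Ha)) :
        GL (Fin N) (mixedSpace L)) = _
  rw [coe_unitaryGroupOfFormCongrOfEq_apply, coe_subgroupCongrTop_apply]

/-! ## §Kf the finite-adelic dock's hypothesis -/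

/-- **(Kf)** the similitude in the shape ★ `finAdelicCongr … Q (inv_ne_zero hc)` consumes: `ᵗ(σQ)·(c⁻¹ • Ha)·Q = Ha′`. [cite: PlatonovRapinchuk1994, §2.3] -/
theorem formCongr_inv_smul_of_simil (c : L) (hc : c ≠ 0) (Q : GL (Fin N) L)
    (hQ : (((Q : GL (Fin N) L) : Matrix (Fin N) (Fin N) L).map (cmConjRingHom L))ᵀ * Ha * ((Q : GL (Fin N) L) : Matrix (Fin N) (Fin N) L) = c • Ha') :
    formCongr ((IsCMField.complexConj L : L ≃ₐ[↥(maximalRealSubfield L)] L) : L →+* L) Q (c⁻¹ • Ha) = Ha' := by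
  show (((Q : GL (Fin N) L) : Matrix (Fin N) (Fin N) L).map (cmConjRingHom L))ᵀ * (c⁻¹ • Ha) * ((Q : GL (Fin N) L) : Matrix (Fin N) (Fin N) L) = Ha'
  rw [Matrix.mul_smul, Matrix.smul_mul, hQ, smul_smul, inv_mul_cancel₀ hc, one_smul]

/-! ## §K3 the lattice is carried to the lattice -/

/-- **(K3)** any value-`Q x Q⁻¹` iso carries `U(Ha′)(L⁺)` onto `U(Ha)(L⁺)`: `Φ x ∈ (cmDatum L N Ha).quotientSubgroup ↔ x ∈ (cmDatum L N Ha′).quotientSubgroup` (`Q` is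
rational; ★ `adelicUnitaryGroupCongr_mem_quotientSubgroup_iff` for the congruence `U(c • Ha′) → U(Ha)`, and `U(c • Ha′)(L⁺) = U(Ha′)(L⁺)`). [cite: PlatonovRapinchuk1994, §2.3, §5.1] [cite: Rogawski1990, §14.5 p. 238] -/
theorem similCongr_mem_quotientSubgroup_iff (c : L) (hc : c ≠ 0) (Q : GL (Fin N) L)
    (hQ : (((Q : GL (Fin N) L) : Matrix (Fin N) (Fin N) L).map (cmConjRingHom L))ᵀ * Ha * ((Q : GL (Fin N) L) : Matrix (Fin N) (Fin N) L) = c • Ha')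
    (Φ : (cmDatum L N Ha').Adelic ≃ₜ* (cmDatum L N Ha).Adelic)
    (hΦ : ∀ x : (cmDatum L N Ha').Adelic, (Subtype.val (Φ x) : GL (Fin N) (AdeleRing (𝓞 L) L)) = toAdeleGL L Q * (Subtype.val x : GL (Fin N) (AdeleRing (𝓞 L) L)) * (toAdeleGL L Q)⁻¹)
    (x : (cmDatum L N Ha').Adelic) :
    Φ x ∈ (cmDatum L N Ha).quotientSubgroup ↔ x ∈ (cmDatum L N Ha').quotientSubgroup := by
  have hA : adelicUnitaryGroup L Ha' = adelicUnitaryGroup L (c • Ha') := (simil_adelicUnitaryGroup_smul_eq L N hc Ha').symm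
  -- `Φ` agrees with the composite `congruence ∘ hop` (both have the value `Q x Q⁻¹`)
  have hΦeq : Φ x = adelicUnitaryGroupCongr L Q Ha (c • Ha') hQ (subgroupCongrTop hA x) := by
    apply Subtype.ext
    rw [hΦ, coe_adelicUnitaryGroupCongr, coe_subgroupCongrTop_apply]
  have key := adelicUnitaryGroupCongr_mem_quotientSubgroup_iff L Q hQ (subgroupCongrTop hA x)
  rw [hΦeq]
  refine key.trans ?_
  -- the hop: `U(c • Ha′)(L⁺) = U(Ha′)(L⁺)` read through `mem_adelicUnitaryRat_iff`
  rw [cmDatum_quotientSubgroup, cmDatum_quotientSubgroup]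
  refine (mem_adelicUnitaryRat_iff L (c • Ha') _).trans (Iff.trans ?_ (mem_adelicUnitaryRat_iff L Ha' x).symm)
  rw [Literature.NumberTheory.Rogawski1990.unitaryGroup_smul_eq _ (IsUnit.mk0 _ hc), coe_subgroupCongrTop_apply]

/-! ## §K4–K6 the value laws commute with `archPart`, `finPart`, `adelicProdEquiv.symm` -/

/-- **(K4)** `archPart (Φ x) = Φ∞ (archPart x)` for value-characterised `Φ`, `Φ∞` (`(Q_𝔸)_∞ = Q ⊗ 1`, ★ `toMixed_toAdeleGL`). [cite: BorelJacquet1979, §4.1] [cite: PlatonovRapinchuk1994, §5.1] -/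
theorem archPart_similCongr (Q : GL (Fin N) L)
    (Φ : (cmDatum L N Ha').Adelic ≃ₜ* (cmDatum L N Ha).Adelic)
    (hΦ : ∀ x : (cmDatum L N Ha').Adelic, (Subtype.val (Φ x) : GL (Fin N) (AdeleRing (𝓞 L) L)) = toAdeleGL L Q * (Subtype.val x : GL (Fin N) (AdeleRing (𝓞 L) L)) * (toAdeleGL L Q)⁻¹)
    (Φi : ↥(arch (↥(maximalRealSubfield L)) L (IsCMField.complexConj L) N Ha') ≃ₜ* ↥(arch (↥(maximalRealSubfield L)) L (IsCMField.complexConj L) N Ha))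
    (hΦi : ∀ g : ↥(arch (↥(maximalRealSubfield L)) L (IsCMField.complexConj L) N Ha'),
      ((Φi g : ↥(arch (↥(maximalRealSubfield L)) L (IsCMField.complexConj L) N Ha)) : GL (Fin N) (mixedSpace L)) =
        Matrix.GeneralLinearGroup.map (mixedEmbedding L) Q * (g : GL (Fin N) (mixedSpace L)) * (Matrix.GeneralLinearGroup.map (mixedEmbedding L) Q)⁻¹)
    (x : (cmDatum L N Ha').Adelic) :
    archPart (↥(maximalRealSubfield L)) L (IsCMField.complexConj L) N Ha (Φ x) = Φi (archPart (↥(maximalRealSubfield L)) L (IsCMField.complexConj L) N Ha' x) := by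
  refine Subtype.ext ?_
  rw [coe_archPart, hΦi, coe_archPart]
  change GLn.toMixed N L (Subtype.val (Φ x) : GL (Fin N) (AdeleRing (𝓞 L) L)) =
    Matrix.GeneralLinearGroup.map (mixedEmbedding L) Q * GLn.toMixed N L (Subtype.val x : GL (Fin N) (AdeleRing (𝓞 L) L)) * (Matrix.GeneralLinearGroup.map (mixedEmbedding L) Q)⁻¹
  rw [hΦ, map_mul, map_mul, map_inv, toMixed_toAdeleGL]

/-- **(K5)** `finPart (Φ x) = Φf (finPart x)` for value-characterised `Φ`, `Φf` (`(Q_𝔸)_f = Q_f`, ★ `sndHom_toAdeleGL`). [cite: BorelJacquet1979, §4.1] [cite: PlatonovRapinchuk1994, §5.1] -/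
theorem finPart_similCongr (Q : GL (Fin N) L)
    (Φ : (cmDatum L N Ha').Adelic ≃ₜ* (cmDatum L N Ha).Adelic)
    (hΦ : ∀ x : (cmDatum L N Ha').Adelic, (Subtype.val (Φ x) : GL (Fin N) (AdeleRing (𝓞 L) L)) = toAdeleGL L Q * (Subtype.val x : GL (Fin N) (AdeleRing (𝓞 L) L)) * (toAdeleGL L Q)⁻¹)
    (Φf : ↥(finAdelic (↥(maximalRealSubfield L)) L (IsCMField.complexConj L) N Ha') ≃ₜ* ↥(finAdelic (↥(maximalRealSubfield L)) L (IsCMField.complexConj L) N Ha))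
    (hΦf : ∀ z : ↥(finAdelic (↥(maximalRealSubfield L)) L (IsCMField.complexConj L) N Ha'),
      ((Φf z : ↥(finAdelic (↥(maximalRealSubfield L)) L (IsCMField.complexConj L) N Ha)) : GL (Fin N) (FiniteAdeleRing (𝓞 L) L)) =
        toFinAdeleGL L N Q * (z : GL (Fin N) (FiniteAdeleRing (𝓞 L) L)) * (toFinAdeleGL L N Q)⁻¹)
    (x : (cmDatum L N Ha').Adelic) :
    finPart (↥(maximalRealSubfield L)) L (IsCMField.complexConj L) N Ha (Φ x) = Φf (finPart (↥(maximalRealSubfield L)) L (IsCMField.complexConj L) N Ha' x) := by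
  refine Subtype.ext ?_
  rw [coe_finPart, hΦf, coe_finPart]
  change GLn.sndHom N L (Subtype.val (Φ x) : GL (Fin N) (AdeleRing (𝓞 L) L)) =
    toFinAdeleGL L N Q * GLn.sndHom N L (Subtype.val x : GL (Fin N) (AdeleRing (𝓞 L) L)) * (toFinAdeleGL L N Q)⁻¹
  rw [hΦ, map_mul, map_mul, map_inv, sndHom_toAdeleGL]

/-- **(K6)** `Φ (e′⁻¹ (y, z)) = e⁻¹ (Φ∞ y, Φf z)` for the inverse product decompositions `e = adelicProdEquiv.symm` — the shape in which a recipe measure given as an `e′⁻¹`-image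
of a product is carried by `Φ`. [cite: BorelJacquet1979, §4.1] [cite: Rogawski1990, §14.5 p. 239] -/
theorem similCongr_adelicProdEquiv_symm (Q : GL (Fin N) L)
    (Φ : (cmDatum L N Ha').Adelic ≃ₜ* (cmDatum L N Ha).Adelic)
    (hΦ : ∀ x : (cmDatum L N Ha').Adelic, (Subtype.val (Φ x) : GL (Fin N) (AdeleRing (𝓞 L) L)) = toAdeleGL L Q * (Subtype.val x : GL (Fin N) (AdeleRing (𝓞 L) L)) * (toAdeleGL L Q)⁻¹)
    (Φi : ↥(arch (↥(maximalRealSubfield L)) L (IsCMField.complexConj L) N Ha') ≃ₜ* ↥(arch (↥(maximalRealSubfield L)) L (IsCMField.complexConj L) N Ha))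
    (hΦi : ∀ g : ↥(arch (↥(maximalRealSubfield L)) L (IsCMField.complexConj L) N Ha'),
      ((Φi g : ↥(arch (↥(maximalRealSubfield L)) L (IsCMField.complexConj L) N Ha)) : GL (Fin N) (mixedSpace L)) =
        Matrix.GeneralLinearGroup.map (mixedEmbedding L) Q * (g : GL (Fin N) (mixedSpace L)) * (Matrix.GeneralLinearGroup.map (mixedEmbedding L) Q)⁻¹)
    (Φf : ↥(finAdelic (↥(maximalRealSubfield L)) L (IsCMField.complexConj L) N Ha') ≃ₜ* ↥(finAdelic (↥(maximalRealSubfield L)) L (IsCMField.complexConj L) N Ha))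
    (hΦf : ∀ z : ↥(finAdelic (↥(maximalRealSubfield L)) L (IsCMField.complexConj L) N Ha'),
      ((Φf z : ↥(finAdelic (↥(maximalRealSubfield L)) L (IsCMField.complexConj L) N Ha)) : GL (Fin N) (FiniteAdeleRing (𝓞 L) L)) =
        toFinAdeleGL L N Q * (z : GL (Fin N) (FiniteAdeleRing (𝓞 L) L)) * (toFinAdeleGL L N Q)⁻¹)
    (y : ↥(arch (↥(maximalRealSubfield L)) L (IsCMField.complexConj L) N Ha')) (z : ↥(finAdelic (↥(maximalRealSubfield L)) L (IsCMField.complexConj L) N Ha')) :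
    Φ ((adelicProdEquiv (↥(maximalRealSubfield L)) L (IsCMField.complexConj L) N Ha').symm (y, z)) =
      (adelicProdEquiv (↥(maximalRealSubfield L)) L (IsCMField.complexConj L) N Ha).symm (Φi y, Φf z) := by
  set w := (adelicProdEquiv (↥(maximalRealSubfield L)) L (IsCMField.complexConj L) N Ha').symm (y, z) with hw
  have hyz : adelicProdEquiv (↥(maximalRealSubfield L)) L (IsCMField.complexConj L) N Ha' w = (y, z) := by
    rw [hw, ContinuousMulEquiv.apply_symm_apply]
  have hy : archPart (↥(maximalRealSubfield L)) L (IsCMField.complexConj L) N Ha' w = y := by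
    have h := congrArg Prod.fst hyz
    rwa [adelicProdEquiv_apply] at h
  have hz : finPart (↥(maximalRealSubfield L)) L (IsCMField.complexConj L) N Ha' w = z := by
    have h := congrArg Prod.snd hyz
    rwa [adelicProdEquiv_apply] at h
  have h := adelicProdEquiv_apply (↥(maximalRealSubfield L)) L (IsCMField.complexConj L) N Ha (Φ w)
  rw [archPart_similCongr L N Ha Ha' Q Φ hΦ Φi hΦi w, finPart_similCongr L N Ha Ha' Q Φ hΦ Φf hΦf w, hy, hz] at h
  rw [← h, ContinuousMulEquiv.symm_apply_apply]

end Simil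

end UnitaryGroup

end Literature.NumberTheory.Automorphic

end
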